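import Mathlib
import HarnessLib
import HarnessLib.Audit
import Summits.PneNP.Statement
import Literature.Computability.Complexity.Classes
import Literature.Computability.Complexity.Nondeterministic
import Literature.Computability.Complexity.BoolEncodings
import Literature.Computability.Complexity.GraphEncodings
import Literature.Computability.Complexity.PolyHierarchy
import Literature.Computability.Complexity.TimeBounds
import Literature.Computability.Complexity.ClayProblem
import Literature.Computability.Complexity.ClayProblemProofs
import Literature.Computability.Complexity.NondeterministicProofs
import Literature.Computability.Complexity.CNF
import Literature.Computability.MetaComplexity.Frege
import Literature.Computability.MetaComplexity.UniversalMachine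
import HarnessLib.Audit.Status.Attr

/-!
Route: RamseyAliens

DORMANT since 2026-08-23T14:39:27Z (reconciler: no traction for 6.1 d (last activity item-evidence-added at 2026-08-17T12:19:37Z); parked, not closed — `ledger route dormant route-PneNP-RamseyAliens --off` to reactivate) — unstaffed, not closed; items shared with open routes are served there. `ledger route dormant <id> --off` reactivates.

Thesis X (target `NoExtremalPrinter`; realises card PneNP/PneNP/ramsey-numbers-beyond-exp,
sharpened). Words: EXTREMAL DIAGONAL RAMSEY COLOURINGS CANNOT BE WRITTEN DOWN IN TIME POLYNOMIAL IN
THEIR SIZE — there is no algorithm that, on input 1^k, outputs a 2-colouring of K_{R(k,k)-1} with no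
monochromatic K_k within c·R(k,k)^c + c steps. Headline form (crux `RamseyNotP`, which implies X):
R(k,k) is not computable in time 2^{O(k)}, i.e. the unary language L_R = {⟨1^m,1^k⟩ : m < R(k,k)} is
not in P. Since L_R ∈ Σ₂ᵖ (guess the colouring, check all k-subsets), P = NP collapses Σ₂ᵖ to P AT
THE SCALE OF THE OBJECT (m ≤ 4^k) and yields the decider and, by prefix search over the extension
relation, the printer; hence X ⇒ P ≠ NP ("Erdős's aliens were right ⇒ P ≠ NP"). The card's
hypothesis '2^{poly(k)}' is thereby weakened to 'poly(R(k,k))' ⊆ '2^{O(k)}' with the same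
conclusion.
Lean (elaborates, Sketch.lean rc 0; R(k,k) is inlined as sInf {m | ∀ G : SimpleGraph (Fin m),
¬G.CliqueFree k ∨ ¬Gᶜ.CliqueFree k}; all constants `lean search`ed:
Literature.Computability.Complexity.TimeComputable, encodingGraph, boolPair, Classes.P, SigmaP,
DTIME, P_bool_eq, NP_bool_eq, P_subset_NP;
Literature.Computability.MetaComplexity.UniversalMachine.ktAt, textbookFrege,
FregeSystem.IsDepthProofOf, proofSize; Computability.unaryEncodeNat; SimpleGraph.CliqueFree):
NoExtremalPrinter := ¬ ∃ (c : ℕ) (f : ℕ → Σ n, SimpleGraph (Fin n)), TimeComputable unaryEncodeNat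
encodingGraph.encode f (fun k => c * R k ^ c + c) ∧ ∀ k, 2 ≤ k → (f k).1 + 1 = R k ∧ (f
k).2.CliqueFree k ∧ (f k).2ᶜ.CliqueFree k

Rationale: ## Why this line (widen: Ramsey/extremal combinatorics × sparse-set structural complexity ×
propositional proof complexity)
Erdős's joke ("if aliens demand R(6,6), attack the aliens") made precise: P = NP puts every PH
question about 2-colourings of K_m into poly(m) time, so the 90-year failure to locate R(k,k) inside
[2^{k/2}, 4^k] (Erdos1947; Erdős–Szekeres 1935; Campos–Griffiths–Morris–Sahasrabudhe
arXiv:2303.09521: (4−ε)^k) becomes a hardness hypothesis one padding step above P ≠ NP — the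
tally/sparse upward-collapse genre (Book1974, HartmanisImmermanSewelson1985) applied to ONE explicit
extremal object per k (prior complexity work on Ramsey, Burr1990 and Schaefer, is about arrowing for
explicitly given graphs — NP- /Π₂ᵖ-complete — not about the diagonal function at unary scale). What
the line imports that SAT-centred routes do not: its cruxes are statements of extremal combinatorics
and of proof length — (L) are EXACTLY extremal Ramsey colourings structured (Paley at k = 3, 4;
circulant record colourings, Exoo1989) or random-like and incompressible (pseudo-randomness of
Ramsey graphs: PromelRodl1999, BukhSudakov2007)? (U) do TIGHT upper bounds cost long proofs — a
theorem for bounded-depth Frege exactly at the critical r_k (Krajicek2010 Thm 1.1, PHP pull-back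
along an extremal colouring), false at 4^k (Pudlak1991: quasi-polynomial), open everywhere in
between, with the CGMS improvement as the test case. Catalogue used: reformulation (function ↦ tally
Σ₂ᵖ language ↦ search problem), Kolmogorov incompressibility of extremal objects (the calibration
rule of card inconstructible-extremes-calibrated: bet on the exact extreme, never on (1−ε)·extreme),
proof-complexity ladder; no physical analogy.
## Two-layer plan (D-0019): cruxes now, glue later
Target NoExtremalPrinter (rank 0). Assembly (1): P_bool_eq → NP_bool_eq → P_subset_NP →
PrinterOfPEqNP → NoExtremalPrinter → PneNP; the three bridges are PROVED facts (P_bool_eq_holds,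
NP_bool_eq_holds, P_subset_NP_holds), PrinterOfPEqNP (P = NP ⇒ Σ₂ᵖ = P ⇒ decider for L_R + prefix
search ⇒ output-polynomial extremal printer) is the one non-propositional step; no unproved
Literature fact is in the import cone.
Ranked cruxes: #2 ExtremalIncompressible (side L at exact extremality, K^{poly}; ⇒ X by glue
IncompressibleGivesTarget) · #3 RamseyNotP (decision/headline form; ⇒ X by glue DecisionGivesTarget,
and has its own cheap spine DecisionAssembly through RamseySigmaTwo) · #4 NearCriticalHardAC0 and #5
SubFourHardAC0 (side U: rungs of RamseyNotP for algorithms whose rejections are bounded-depth-Frege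
certified; #5 is the CGMS question) · #6 RamseyQuasiPoly (negative side: R(k,k) computable in
2^{poly k}). Support (rank 9): PrinterOfPEqNP, RamseySigmaTwo (CLIQUE_mem_NP is proved; rest is
closure under FP preimages), DecisionAssembly, IncompressibleGivesTarget, DecisionGivesTarget,
CriticalHardAC0 (KNOWN: Krajicek2010 Thm 1.1; rung 1 of side U), ErdosSzekeres (R(k,k) ≤ 4^k —
Mathlib has no Ramsey numbers; needed by PrinterOfPEqNP and by #5 ⇒ #4).
## Kill criteria
RamseyQuasiPoly proved (e.g. from 'extremal colourings are cyclotomic with polylog descriptions' +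
poly-checkable certificates of the tight upper bounds): the card's thesis is dead — close the route
(X formally survives only as a QP-vs-P curiosity, not worth staffing). ExtremalIncompressible
refuted by an explicit extremal family for all large k: drop side L, keep the decision line and
record the structural theorem. SubFourHardAC0 refuted (CGMS formalises in approximate-counting
bounded arithmetic ⇒ quasi-poly depth-O(1) Frege proofs of RAM((4−ε₀)^k, k)): record 'the
exponential improvement is AC⁰-cheap', keep NearCriticalHardAC0. PrinterOfPEqNP found unprovable AS
TYPED (encoding or degenerate-k slip): restate 1:1, do not close.
## Deliberately NOT decomposed yet
The function form 'k ↦ R(k,k) ∉ TIME(2^{O(k)})' ⇔ RamseyNotP (needs Erdos1947 and Erdős–Szekeres as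
lemmas); the search-at-given-m variant; off-diagonal and multicolour numbers; the adjacent
R(log)/T²₂-vs-T³₂ problem for RAM(4^k,k) (Krajicek2010 intro, Pudlak2012) — not ours; Frege/EF-level
side U (conceded hopeless, not filed); which universal-machine conventions matter for #2 (none: ∀
U). Sources: Erdos1947, Book1974, HartmanisImmermanSewelson1985, Burr1990, Pudlak1991, Krajicek2010,
Pudlak2012, Exoo1989, PromelRodl1999, BukhSudakov2007, KrajicekPudlakWoods1995,
PitassiBeameImpagliazzo1993, CookReckhow1979, LiuPass2020, arXiv:2303.09521.

Novelty: NOVELTY (search-before-claim, 2026-08-15 ~11:00–11:45Z). Searched: `lit search` crossref/zbmath (s2,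
openalex, arxiv rate-limited; searchd FTS unavailable this session) for "computational complexity of
computing Ramsey numbers", "Ramsey theorem resolution lower bound Pudlak", "extremal Ramsey
colorings structure cyclic", "Ramsey numbers sparse sets exponential hierarchy", "on the difficulty
of computing Ramsey numbers" (hits: Burr1990; Gaitan–Clark adiabatic computation of small R(m,n),
doi:10.1103/physrevlett.108.010501; Dransfield–Liu–Marek–Truszczyński SAT computation of van der
Waerden numbers — all instance-level, none on the unary-scale complexity of the diagonal function);
`lit galaxy search --star all` for "computing Ramsey numbers", "proof complexity of Ramsey",
"complexity of computing Ramsey numbers" (0 rows), calibration "Ramsey number"/"Ramsey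
graphs"/"tally languages" (noise only — the substring index is no evidence either way); `lit
frontier PneNP --since 2020`, `lit bridges PneNP --cross any` (no Ramsey-theoretic descendant of the
summit's roots); READ in full text Krajicek2010 = doi:10.1007/s00153-010-0212-9 pp. 1–6 (Thm 1.1:
depth-d Frege proofs of RAM(r_k,k) have size ≥ 2^{r_k^ε}, by pulling PHP_{r_k−1} back along an
extremal colouring of K_{r_k−1}; RAM(4^k,k) has quasi-polynomial depth-O(1) proofs by Pudlak1991;
R(log)/resolution status of RAM(4^k,k) open, tied to T²₂ vs T³₂) and Pudlak2012 =
doi:10.1016/j.ipl.2012.05.004 (resolution size ≥ 2^{n^{1/4−o(1)}  [refs: 10.1103/physrevlett.108.010501, 10.1007/s00153-010-0212-9, 10.1016/j.ipl.2012.05.004, 2303.09521, doi:10.1103/physrevlett.108.010501, doi:10.1007/s00153-010-0212-9, doi:10.1016/j.ipl.2012.05.004, Burr1990, Krajicek2010, Pudlak1991, Pudlak2012, Book1974, HartmanisImmermanSewelson1985, PromelRodl1999, BukhSudakov2007]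

Barriers (technique_class: tally-collapse, extremal-incompressibility, AC0-Frege-Ramsey): - Literature.Barriers.PneNP.Relativization / Literature.Barriers.PneNP.BoundedRelativization /
Literature.Barriers.PneNP.Algebrization: APPLY to the assembly and to the top statements
(NoExtremalPrinter, RamseyNotP): X ⇒ P ≠ NP is a padding/collapse argument that relativizes, so
relative to any oracle A with P^A = NP^A the relativized X fails, and any proof of X must be
non-relativizing (and non-algebrizing). Not evaded at the top; the bet is that X concerns ONE
explicit arithmetic object per k and that the cruxes beneath it — ExtremalIncompressible (Kolmogorov
incompressibility of exactly extremal colourings) and NearCriticalHardAC0 / SubFourHardAC0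
(switching-lemma / forcing lower bounds for explicit narrow DNF tautologies, the technology of
KrajicekPudlakWoods1995, PitassiBeameImpagliazzo1993, Krajicek2010) — are oracle-free finite
combinatorics.
- Literature.Barriers.PneNP.RelativizationNarrow (sparse/tally relativization, Long–Selman:
`not_cRelativizes_tally_P_eq_NP_iff` — a TALLY no-go against P = NP is itself a proof of P ≠ NP):
relevant in spirit and conceded — RamseyNotP is a tally statement of Σ₂E ≠ E strength, strictly
above P ≠ NP; the route does not pretend the top statement is easier than the summit, only that its
shadow cruxes are concrete.
- Literature.Barriers.PneNP.NaturalProofs / Literature.Barriers.PneNP.NaturalProofsTC0: do NOT apply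
in form — no large constructive property of truth tables is proposed; ExtremalIncompressible speaks
about a sparse (one obj

Novelty grade: new-combination — ROUTE REVIEW (refuter rreview-ab8e18b7, 2026-08-15). Saturated before me (≥5 refuters/≥13 grounders; 14/14 grounded+checked; 2271/2279 proofs on file; 2283 in tree p39785). PRECISION: all 14 rc0; the one mis-typing (2275: ε≥8, even k ⇒ m=4^k in window, false by Pudlák 1991) was ALREADY re-typed with (refuter refuter-rreview-route-PneNP-RamseyAliens-ab8e18b7-0, 2026-08-15T12:20:09Z; prior: Book1974,HartmanisImmermanSewelson1985,Krajicek2010(doi:10.1007/s00153-010-0212-9),Pudlak1991,Pudlak2012,arXiv:2303.09521,Burr1990,Schaefer2001(doi:10.1006/jcss.2000.1729))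

History (route lifecycle, newest last):
- 2026-08-16T04:14:37Z · AUTO-CRUX (backfill): NoExtremalPrinter — hypotheses of the deciding theorem that nothing in the route derives are cruxes (operator:999:1085951)
- 2026-08-23T14:39:27Z · DORMANT — reconciler: no traction for 6.1 d (last activity item-evidence-added at 2026-08-17T12:19:37Z); parked, not closed — `ledger route dormant route-PneNP-RamseyAlie (operator:999:1180337)

sub-problem: PneNP · status: dormant · opened planner-plancard-PneNP-PneNP-ramsey-numbers-b-910d2a1d-0 2026-08-15T11:02:43Z · rev 2 · ledger route-PneNP-RamseyAliens
GENERATED by the gate from the ledger (D-0016/17). Provers cite these decls: `theorem foo : Summit.PneNP.PneNP.Theses.RamseyAliens.<Decl> := …` in Summits/PneNP/PneNP/Theorems/<Name>.lean.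
-/

namespace Summit.PneNP.PneNP.Theses.RamseyAliens

open scoped BigOperators Topology Manifold Classical MeasureTheory ProbabilityTheory Matrix InnerProductSpace ComplexConjugate ContinuousMap
open Filter Set Function TopologicalSpace MeasureTheory

attribute [summit_statement] _root_.PneNP

open Literature.PNP

/-- item stmt-PneNP-2270 · crux (kind.auto-crux: conjecture-grade) · rank 0 · open · by planner
why it might fail: It is a superpolynomial UNIFORM lower bound for an explicit sparse Σ₂ᵖ search problem (Σ₂E ≠ E strength); and it is false outright if extremal colourings admit a closed-form/algebraic description computable in poly(R) time for all large k (Paley IS extremal at k = 3, 4).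
sources: Erdos1947, HartmanisImmermanSewelson1985, Exoo1989, arXiv:2303.09521
[target] Thesis X of route RamseyAliens (card ramsey-numbers-beyond-exp, search form): there is no
output-polynomial-time printer of extremal diagonal Ramsey colourings — no c and no f : ℕ → (graph),
computable on unary input 1^k within c·R(k,k)^c + c TM2 steps (output encoded by encodingGraph),
such that for every k ≥ 2 the graph f(k) has exactly R(k,k) − 1 vertices and neither it nor its
complement has a k-clique. R(k,k) (inlined as sInf {m | every 2-colouring of K_m has a monochromatic
K_k}). Implied by RamseyNotP (DecisionGivesTarget) and by ExtremalIncompressible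
(IncompressibleGivesTarget); P = NP ⇒ ¬X via PrinterOfPEqNP. k ≥ 2 avoids the degenerate k = 0 (no
0-clique-free graph). -/
@[route_item "route-PneNP-RamseyAliens", crux]
def NoExtremalPrinter : Prop :=
  ¬ ∃ (c : ℕ) (f : ℕ → Σ n, SimpleGraph (Fin n)), Literature.Computability.Complexity.TimeComputable Computability.unaryEncodeNat Literature.Computability.Complexity.encodingGraph.encode f (fun k => c * sInf {m : ℕ | ∀ G : SimpleGraph (Fin m), ¬ G.CliqueFree k ∨ ¬ Gᶜ.CliqueFree k} ^ c + c) ∧ ∀ k, 2 ≤ k → (f k).1 + 1 = sInf {m : ℕ | ∀ G : SimpleGraph (Fin m), ¬ G.CliqueFree k ∨ ¬ Gᶜ.CliqueFree k} ∧ (f k).2.CliqueFree k ∧ (f k).2ᶜ.CliqueFree k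

/-- item stmt-PneNP-2272 · crux · rank 2 · open · by planner
why it might fail: Paley IS extremal at k = 3, 4 (K = O(log m)); small-k record colourings are circulant (Exoo1989); false if for all large k some extremal colouring is cyclotomic; no incompressibility theorem for EXACTLY extremal objects exists — may be true yet unprovable before R(k,k) is located.
sources: Exoo1989, PromelRodl1999, BukhSudakov2007, LiuPass2020
[crux] Side L at EXACT extremality (card C1, sharpened): for every efficient universal machine U and
every c there is δ > 0 such that for infinitely many k EVERY k-Ramsey 2-colouring G of K_{R(k,k)−1}
(G.CliqueFree k ∧ Gᶜ.CliqueFree k on m = R(k,k) − 1 vertices) has time-bounded Kolmogorov complexity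
K^{m^c + c}(code of ⟨m, G⟩) ≥ ⌈m^δ⌉: extremal colourings are not polylog-succinct, i.e. sit on the
'random' side of structure-vs-randomness at least polynomially. Implies X
(IncompressibleGivesTarget: a printer gives K^{poly}(G_k) ≤ k + O(1) ≤ 2 log₂ m + O(1) via
UniversalMachine.sim). Tools: pseudo-randomness of Ramsey graphs (PromelRodl1999, BukhSudakov2007,
Kwan–Sudakov anticoncentration), incompressibility method. Stated ∃ᶠ k (infinitely often) — the
weakest form that still implies X. -/
@[route_item "route-PneNP-RamseyAliens"]
def ExtremalIncompressible : Prop :=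
  ∀ (U : Literature.Computability.MetaComplexity.UniversalMachine) (c : ℕ), ∃ δ : ℝ, 0 < δ ∧ ∃ᶠ k in Filter.atTop, ∀ G : SimpleGraph (Fin (sInf {m : ℕ | ∀ G : SimpleGraph (Fin m), ¬ G.CliqueFree k ∨ ¬ Gᶜ.CliqueFree k} - 1)), G.CliqueFree k → Gᶜ.CliqueFree k → ((⌈((sInf {m : ℕ | ∀ G : SimpleGraph (Fin m), ¬ G.CliqueFree k ∨ ¬ Gᶜ.CliqueFree k} - 1 : ℕ) : ℝ) ^ δ⌉₊ : ℕ) : ℕ∞) ≤ U.ktAt ((sInf {m : ℕ | ∀ G : SimpleGraph (Fin m), ¬ G.CliqueFree k ∨ ¬ Gᶜ.CliqueFree k} - 1) ^ c + c) (Literature.Computability.Complexity.encodingGraph.encode ⟨sInf {m : ℕ | ∀ G : SimpleGraph (Fin m), ¬ G.CliqueFree k ∨ ¬ Gᶜ.CliqueFree k} - 1, G⟩)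

/-- item stmt-PneNP-2273 · crux · rank 3 · open · by planner
why it might fail: A uniform superpolynomial lower bound for an explicit TALLY Σ₂ᵖ language implies Σ₂E ≠ E — beyond all known technique (RelativizationNarrow: a tally no-go is itself P ≠ NP); false if R(k,k) has a closed form or a 2^{O(k)} dynamic programme over a structured extremal family.
sources: Book1974, HartmanisImmermanSewelson1985, Burr1990, Erdos1947
[crux] Headline/decision form of the card ('Erdős's aliens were right', sharpened from 2^{poly k} to
2^{O(k)}): the unary diagonal-Ramsey language L_R = {boolPair (1^m) (1^k) : some graph on Fin m has
neither a k-clique nor a k-independent set} = {⟨1^m,1^k⟩ : m < R(k,k)} is not in Classes.P;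
equivalently (given Erdos1947's 2^{k/2} lower bound and Erdős–Szekeres) k ↦ R(k,k) is not computable
in time 2^{O(k)}. L_R ∈ Σ₂ᵖ (RamseySigmaTwo), so this implies Σ₂ᵖ ≠ P ⇒ P ≠ NP (DecisionAssembly)
and implies X (DecisionGivesTarget: a clocked run of an output-poly printer decides L_R). Its
restricted-model rungs are NearCriticalHardAC0 / SubFourHardAC0 (algorithms whose rejections 'm ≥
R(k,k)' carry bounded-depth Frege certificates). -/
@[route_item "route-PneNP-RamseyAliens"]
def RamseyNotP : Prop :=
  {w : List Bool | ∃ m k : ℕ, w = Literature.Computability.Complexity.boolPair (Computability.unaryEncodeNat m) (Computability.unaryEncodeNat k) ∧ ∃ G : SimpleGraph (Fin m), G.CliqueFree k ∧ Gᶜ.CliqueFree k} ∉ Literature.Computability.Complexity.Classes.P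

/-- item stmt-PneNP-2274 · crux · rank 4 · open · by planner
why it might fail: The one known mechanism (Krajicek2010: PHP pulled back along an extremal colouring) needs m = r_k exactly; at (1+ε)r_k it degrades to weak PHP (quasi-poly/open in bounded depth), so it may be true but out of reach; false if bounded-depth Frege certifies R(k,k) ≤ m for some m ≤ 2r_k.
sources: Krajicek2010, Pudlak1991, KrajicekPudlakWoods1995, PitassiBeameImpagliazzo1993
[crux] Side U, near-critical window ('tight upper bounds cost long proofs', robust form): for every
depth d there are δ > 0 and K such that for all k ≥ K and all m ≤ 2·R(k,k), every depth-d
textbookFrege proof π of the Ramsey tautology RAM(m,k) := ¬⋀(clauses 'not all x_e, e ⊆ S' and 'not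
all ¬x_e, e ⊆ S' over k-subsets S ⊆ [m], x_{a·m+b} = colour of edge ab, a < b) has proofSize π ≥
2^{m^δ} (vacuous for m < R(k,k), where RAM(m,k) is not a tautology). Known exactly at m = R(k,k)
(CriticalHardAC0 = Krajicek2010 Thm 1.1); quasi-polynomially FALSE at m = 4^k (Pudlak1991). Factor 2
is where the PHP pull-back provably stops: it yields WPHP^{2n}_n, which has quasi-polynomial
bounded-depth proofs (Paris–Wilkie–Woods), so a proof needs a Ramsey-specific switching lemma over
liftings of extremal colourings. -/
@[route_item "route-PneNP-RamseyAliens"]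
def NearCriticalHardAC0 : Prop :=
  ∀ d : ℕ, ∃ δ : ℝ, 0 < δ ∧ ∃ K : ℕ, ∀ k ≥ K, ∀ m : ℕ, m ≤ 2 * sInf {m : ℕ | ∀ G : SimpleGraph (Fin m), ¬ G.CliqueFree k ∨ ¬ Gᶜ.CliqueFree k} → ∀ π : List (Literature.Computability.Complexity.PropForm ℕ), Literature.Computability.MetaComplexity.textbookFrege.IsDepthProofOf d π (Literature.Computability.Complexity.PropForm.neg (Literature.Computability.Complexity.PropForm.ofCNF (((List.range m).sublistsLen k).flatMap fun S => [((S ×ˢ S).filter fun p => p.1 < p.2).map fun p => (p.1 * m + p.2, false), ((S ×ˢ S).filter fun p => p.1 < p.2).map fun p => (p.1 * m + p.2, true)]))) → (2 : ℝ) ^ ((m : ℝ) ^ δ) ≤ (Literature.Computability.MetaComplexity.proofSize π : ℝ)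

/-- item stmt-PneNP-2275 · crux · rank 5 · open · by planner
why it might fail: CGMS is a density-increment induction with approximate counting; if it formalises in approximate-counting bounded arithmetic (APC₂ / T²₂ + sWPHP), Paris–Wilkie translation gives quasi-poly depth-O(1) proofs of RAM((4−ε₀)^k,k), refuting the crux for ε ≤ ε₀ (informative: 'CGMS is AC⁰-cheap').
sources: arXiv:2303.09521, Pudlak1991, Krajicek2010, Pudlak2012
[crux] Side U, the CGMS question (card C2 moved down to bounded depth, where it is decidable either
way): for every depth d and every ε > 0 there are δ > 0 and K such that for all k ≥ K and all m ≤
(4−ε)^k every depth-d textbookFrege proof of RAM(m,k) has size ≥ 2^{m^δ} — no EXPONENTIAL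
improvement of Erdős–Szekeres (R(k,k) ≤ 4^k, which HAS quasi-polynomial depth-O(1) proofs,
Pudlak1991) is provable in bounded-depth Frege; in particular the
Campos–Griffiths–Morris–Sahasrabudhe book algorithm (arXiv:2303.09521, R(k,k) ≤ (4−ε₀)^k) has no
quasi-polynomial AC⁰-Frege formalisation. Nonvacuous window [R(k,k), (4−ε)^k] is nonempty for ε < ε₀
by CGMS; implies NearCriticalHardAC0 for large k given ErdosSzekeres/CGMS (2R ≤ (4−ε)^k). -/
@[route_item "route-PneNP-RamseyAliens"]
def SubFourHardAC0 : Prop :=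
  ∀ (d : ℕ) (ε : ℝ), 0 < ε → ε < 4 → ∃ δ : ℝ, 0 < δ ∧ ∃ K : ℕ, ∀ k ≥ K, ∀ m : ℕ, (m : ℝ) ≤ (4 - ε) ^ k → ∀ π : List (Literature.Computability.Complexity.PropForm ℕ), Literature.Computability.MetaComplexity.textbookFrege.IsDepthProofOf d π (Literature.Computability.Complexity.PropForm.neg (Literature.Computability.Complexity.PropForm.ofCNF (((List.range m).sublistsLen k).flatMap fun S => [((S ×ˢ S).filter fun p => p.1 < p.2).map fun p => (p.1 * m + p.2, false), ((S ×ˢ S).filter fun p => p.1 < p.2).map fun p => (p.1 * m + p.2, true)]))) → (2 : ℝ) ^ ((m : ℝ) ^ δ) ≤ (Literature.Computability.MetaComplexity.proofSize π : ℝ)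

/-- item stmt-PneNP-2276 · crux · rank 6 · open · by planner
why it might fail: Almost certainly unprovable today: even certifying the clique number of Paley graphs below √p is open, and exhaustive methods die at 2^{Θ(m²)} (43 ≤ R(5,5) ≤ 46 after massive computation, Exoo1989 / Angeltveit–McKay); staffed as the kill switch, not as a belief.
sources: Exoo1989, Burr1990, HartmanisImmermanSewelson1985
[crux] NEGATIVE SIDE / kill switch, calibrated to the card's original threshold: L_R ∈ ⋃_c
DTIME(2^{(log n + 1)^c}), i.e. R(k,k) is computable in time 2^{poly(k)} (quasi-polynomial in the
size 4^k of the object). Weaker than ¬RamseyNotP, hence the achievable refutation: it would follow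
from 'for all large k some extremal colouring is cyclotomic/Cayley with a polylog(m) description'
PLUS poly- or quasi-poly-checkable certificates of the matching upper bounds R(k,k) ≤ m. Proved ⇒
route closed by kill criterion (the card's thesis is dead; X survives only formally). Staffed so
refuters attack the line directly; note vertex-transitivity alone only cuts 2^{m²} to 2^{Θ(m)} and
does NOT suffice. -/
@[route_item "route-PneNP-RamseyAliens"]
def RamseyQuasiPoly : Prop :=
  {w : List Bool | ∃ m k : ℕ, w = Literature.Computability.Complexity.boolPair (Computability.unaryEncodeNat m) (Computability.unaryEncodeNat k) ∧ ∃ G : SimpleGraph (Fin m), G.CliqueFree k ∧ Gᶜ.CliqueFree k} ∈ ⋃ c : ℕ, Literature.Computability.Complexity.DTIME (fun n => 2 ^ ((Nat.log 2 n + 1) ^ c))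

/-- item stmt-PneNP-2277 · support · rank 9 · open · by planner
[support] Assembly lemma (routine in print, laborious in Lean): if Classes.P = NP then an
output-polynomial extremal printer exists. Print proof: P = NP ⇒ Σ₂ᵖ = polyExists (co (polyExists
(co P))) = P (sigmaP_succ, co_P_holds) ⇒ L_R ∈ P (RamseySigmaTwo) and the extension/search relation
{(⟨1^m,1^k⟩, G) : G k-Ramsey on Fin m} ∈ co NP = P, so
Literature.Computability.Complexity.exists_certificateFn_of_P_eq_NP gives an FP finder of good
colourings; on input 1^k scan m = 1, 2, … with the decider (stops at m = R(k,k) ≤ 4^k,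
ErdosSzekeres) and output the finder's colouring at m = R(k,k) − 1; total time Σ_{m ≤ R} poly(m) =
poly(R(k,k)). TM2 plumbing: loop + subroutine composition (IterateFP / LoopUntilFlag / TM2While
infrastructure). -/
@[route_item "route-PneNP-RamseyAliens", crux]
def PrinterOfPEqNP : Prop :=
  Literature.Computability.Complexity.Classes.P = Literature.Computability.Complexity.Nondeterministic.NP → ∃ (c : ℕ) (f : ℕ → Σ n, SimpleGraph (Fin n)), Literature.Computability.Complexity.TimeComputable Computability.unaryEncodeNat Literature.Computability.Complexity.encodingGraph.encode f (fun k => c * sInf {m : ℕ | ∀ G : SimpleGraph (Fin m), ¬ G.CliqueFree k ∨ ¬ Gᶜ.CliqueFree k} ^ c + c) ∧ ∀ k, 2 ≤ k → (f k).1 + 1 = sInf {m : ℕ | ∀ G : SimpleGraph (Fin m), ¬ G.CliqueFree k ∨ ¬ Gᶜ.CliqueFree k} ∧ (f k).2.CliqueFree k ∧ (f k).2ᶜ.CliqueFree k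

/-- item stmt-PneNP-2278 · support · rank 9 · closed · proved by Summit.PneNP.PneNP.Theorems.ramseyAliens_ramseySigmaTwo_proof @ f359a48215d4 (prover) · by planner
[support] L_R ∈ Σ₂ᵖ = SigmaP 2 = polyExists (co (polyExists (co P))): witness y = adjacency bits of
G (m² ≤ |w|² bits), universal z = a k-subset; base predicate in P. Cheapest Lean route:
CLIQUE_mem_NP is PROVED (KarpCliqueNP), so 'G has no k-clique and Gᶜ has no k-clique' is the
intersection of two FP-preimages of CLIQUEᶜ ∈ coNP (maps (w, y) ↦ code(⟨m, G_y⟩, k) and ↦ code(⟨m,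
(G_y)ᶜ⟩, k): unary→binary, bit complement off the diagonal), and polyExists of that coNP language
with witness bound m² is L_R. Needed by DecisionAssembly and PrinterOfPEqNP. -/
@[route_item "route-PneNP-RamseyAliens"]
def RamseySigmaTwo : Prop :=
  {w : List Bool | ∃ m k : ℕ, w = Literature.Computability.Complexity.boolPair (Computability.unaryEncodeNat m) (Computability.unaryEncodeNat k) ∧ ∃ G : SimpleGraph (Fin m), G.CliqueFree k ∧ Gᶜ.CliqueFree k} ∈ Literature.Computability.Complexity.SigmaP 2

/-- item stmt-PneNP-2279 · support · rank 9 · closed · proved by Summit.PneNP.PneNP.Theorems.ramseyAliens_decisionAssembly_proof @ fbcda825582c (prover) · by planner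
[support] Cheap certified spine for the headline form: P_bool_eq → NP_bool_eq → P_subset_NP →
RamseySigmaTwo → RamseyNotP → PneNP. Proof: ¬PneNP ⇒ Classes.P = NP (bridges + antisymm, as
Literature.Learning.pneNP_of_P_ne_NP) ⇒ SigmaP 2 = P by unfolding sigmaP twice with co_P_holds and
NP = polyExists P ⇒ L_R ∈ P, contradiction. Provable now (propositional + two rewrites). -/
@[route_item "route-PneNP-RamseyAliens"]
def DecisionAssembly : Prop :=
  Literature.Computability.Complexity.P_bool_eq → Literature.Computability.Complexity.NP_bool_eq → Literature.Computability.Complexity.P_subset_NP → RamseySigmaTwo → RamseyNotP → PneNP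

/-- item stmt-PneNP-2280 · support · rank 9 · open · by planner
[support] Glue ExtremalIncompressible → NoExtremalPrinter. A printer f with TimeComputable bound
T(k) = c·R(k)^c + c is a TM2 machine M that outputs encodingGraph.encode (f k) = code of ⟨m, G_k⟩ (m
= R(k) − 1, G_k extremal) on unaryEncodeNat k within T(k) steps;
UniversalMachine.exists_ktAt_le_of_outputsWithin gives U.ktAt (p (T k)) (code) ≤ k + 2|e| + 2, and
p(T k) ≤ m^{c'} + c' (R = m + 1), so by ktAt_anti K^{m^{c'}+c'}(code) ≤ k + O(1);
ExtremalIncompressible at (U, c') gives ⌈m^δ⌉ ≤ k + O(1) for infinitely many k — contradiction as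
soon as m = R(k) − 1 grows faster than k^{1/δ}. Two ways to finish: (i) Erdős 1947 counting bound
R(k,k) > 2^{k/2} (k ≥ 3) as an internal lemma (C(m,k)·2^{1−C(k,2)} < 1), or (ii) avoid growth
entirely by simulating M composed with a binary→unary expander on input encodeNat k, which gives K ≤
log₂ k + O(1) and needs only m ≥ k − 1 (K_{k−1} is trivially k-Ramsey). -/
@[route_item "route-PneNP-RamseyAliens"]
def IncompressibleGivesTarget : Prop :=
  ExtremalIncompressible → NoExtremalPrinter

/-- item stmt-PneNP-2281 · support · rank 9 · open · by planner
[support] Glue RamseyNotP → NoExtremalPrinter (contrapositive: an output-polynomial extremal printer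
decides L_R in P): on input ⟨1^m, 1^k⟩ (k ≥ 2) run the printer's machine on 1^k for c·(m+1)^c + c
steps (clocked simulation, cf. ClockedUniversalSimulation infrastructure); if it halts, read off
R(k,k) − 1 = number of vertices of the output and answer [m ≤ R(k,k) − 1]; if it does not halt then
c·R^c + c > c·(m+1)^c + c forces R(k,k) > m + 1, answer yes. Small k (0, 1) by table. Time poly(m +
k). -/
@[route_item "route-PneNP-RamseyAliens"]
def DecisionGivesTarget : Prop :=
  RamseyNotP → NoExtremalPrinter

/-- item stmt-PneNP-2282 · support · rank 9 · closed · proved by Summit.PneNP.PneNP.Theorems.ramseyAliens_criticalHardAC0_proof @ d31ed1acc021 (prover) · by planner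
[support] KNOWN rung 1 of side U (Krajicek2010 = Arch. Math. Logic 50 (2011), Thm 1.1: 'for every d
≥ 2 there is ε > 0 such that for k ≥ 1 every depth-d Frege proof of RAM(r_k, k) must have size at
least 2^{r_k^ε}'): depth-d textbookFrege proofs of the CRITICAL Ramsey tautology RAM(R(k,k), k) have
proofSize ≥ 2^{R(k,k)^δ} for k ≥ K. Proof in print: substitute x_{uv} := ⋁_{{i,j} ∈ E(G)} p_{u,i} ∧
p_{v,j} for an extremal colouring G of K_{r_k − 1} into the proof, derive functional
PHP^{r_k}_{r_k−1} in size s·n² + n^{O(log n)}, and invoke the bounded-depth PHP lower bound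
(KrajicekPudlakWoods1995 / PitassiBeameImpagliazzo1993 — NOTE: for the functional/onto variant,
stronger than the tree's basic-PHP fact boundedDepthFrege_pigeonhole_lowerBound; file that variant
as a cite fact or prove the reduction to basic PHP). Consequence recorded in the rationale: no
algorithm for L_R whose rejections carry poly-size bounded-depth Frege certificates exists —
unconditionally. -/
@[route_item "route-PneNP-RamseyAliens"]
def CriticalHardAC0 : Prop :=
  ∀ d : ℕ, ∃ δ : ℝ, 0 < δ ∧ ∃ K : ℕ, ∀ k ≥ K, ∀ π : List (Literature.Computability.Complexity.PropForm ℕ), Literature.Computability.MetaComplexity.textbookFrege.IsDepthProofOf d π (Literature.Computability.Complexity.PropForm.neg (Literature.Computability.Complexity.PropForm.ofCNF (((List.range (sInf {m : ℕ | ∀ G : SimpleGraph (Fin m), ¬ G.CliqueFree k ∨ ¬ Gᶜ.CliqueFree k})).sublistsLen k).flatMap fun S => [((S ×ˢ S).filter fun p => p.1 < p.2).map fun p => (p.1 * sInf {m : ℕ | ∀ G : SimpleGraph (Fin m), ¬ G.CliqueFree k ∨ ¬ Gᶜ.CliqueFree k} + p.2, false), ((S ×ˢ S).filter fun p => p.1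 < p.2).map fun p => (p.1 * sInf {m : ℕ | ∀ G : SimpleGraph (Fin m), ¬ G.CliqueFree k ∨ ¬ Gᶜ.CliqueFree k} + p.2, true)]))) → (2 : ℝ) ^ (((sInf {m : ℕ | ∀ G : SimpleGraph (Fin m), ¬ G.CliqueFree k ∨ ¬ Gᶜ.CliqueFree k} : ℕ) : ℝ) ^ δ) ≤ (Literature.Computability.MetaComplexity.proofSize π : ℝ)

/-- item stmt-PneNP-2283 · support · rank 9 · closed · proved by Summit.PneNP.PneNP.Theorems.ramseyAliens_erdosSzekeres_proof @ 418cb9eea1f6 (prover) · by planner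
[support] Erdős–Szekeres 1935, diagonal case: every graph on 4^k vertices has a k-clique or a
k-independent set (R(k,k) ≤ C(2k−2, k−1) ≤ 4^k). Mathlib has no Ramsey numbers (searched 'amsey'
decls: none); classical induction R(s,t) ≤ R(s−1,t) + R(s,t−1) via neighbourhood pigeonhole. Needed
by PrinterOfPEqNP (the scan over m terminates and sInf{…} is attained) and for SubFourHardAC0 ⇒
NearCriticalHardAC0; a self-contained formalisation target. -/
@[route_item "route-PneNP-RamseyAliens"]
def ErdosSzekeres : Prop :=
  ∀ k : ℕ, ∀ G : SimpleGraph (Fin (4 ^ k)), ¬ G.CliqueFree k ∨ ¬ Gᶜ.CliqueFree k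

/-- item stmt-PneNP-2271 · assembly · rank 1 · closed · proved by Summit.PneNP.PneNP.Theorems.ramseyAliens_assembly_proof @ 24a778eba535 (prover) · by planner
[assembly] ¬PneNP ⇒ (bridges P_bool_eq, NP_bool_eq — both PROVED, P_bool_eq_holds / NP_bool_eq_holds
— with P_subset_NP_holds and Set.Subset.antisymm, as in Literature.Learning.pneNP_of_P_ne_NP)
Classes.P = NP ⇒ (PrinterOfPEqNP) an output-polynomial extremal printer exists ⇒ contradicts
NoExtremalPrinter. Propositional glue; provable now. -/
@[route_item "route-PneNP-RamseyAliens"]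
def Assembly : Prop :=
  Literature.Computability.Complexity.P_bool_eq → Literature.Computability.Complexity.NP_bool_eq → Literature.Computability.Complexity.P_subset_NP → PrinterOfPEqNP → NoExtremalPrinter → PneNP

/-! D-0027 §2.1 — DECIDING THEOREM (planner-authored via `route open/edit --closes-file`; by planner-rbadge-PneNP-RamseyAliens-2f7afd0c-g2-0 2026-08-15T16:12:42Z):
its hypotheses are this route's items and its conclusion the sub-problem Statement (glue_lint), and it elaborates with this file. -/

@[closes "route-PneNP-RamseyAliens"] theorem closes (hP : PrinterOfPEqNP) (hX : NoExtremalPrinter) : _root_.PneNP := by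
  by_contra h
  have hPeq : Literature.Computability.Complexity.PNPWave0.P Bool = Literature.Computability.Complexity.Classes.P :=
    Literature.Computability.Complexity.P_bool_eq_holds
  have hNeq : Literature.Computability.Complexity.PNPWave0.NP Bool = Literature.Computability.Complexity.Nondeterministic.NP :=
    Literature.Computability.Complexity.NP_bool_eq_holds
  have hsub : Literature.Computability.Complexity.Nondeterministic.NP ⊆ Literature.Computability.Complexity.Classes.P := by
    intro L hL
    by_contra hL'
    exact h ⟨L, hNeq ▸ hL, hPeq ▸ hL'⟩
  have heq : Literature.Computability.Complexity.Classes.P = Literature.Computability.Complexity.Nondeterministic.NP :=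
    (Set.Subset.antisymm hsub Literature.Computability.Complexity.P_subset_NP_holds).symm
  exact hX (hP heq)

end Summit.PneNP.PneNP.Theses.RamseyAliens
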